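import Summits.AtomisticToContinuum.FouriersLaw.Theses.EmbeddedDrudeMourre
import Summits.AtomisticToContinuum.FouriersLaw.Theorems.EmbeddedDrudeMourreAbelThermodynamicLimitWitnessRegularisation
import Literature.MathematicalPhysics.KineticTheory.InfiniteChainGibbsUniqueness
import HarnessLib

/-!
# `stub_regularDLRUnique` of line `loomis-compact-horizon-witness` — DLR UNIQUENESS IN THE
# REGULAR CLASS, PROVED
(crux `EmbeddedDrudeMourre.AbelThermodynamicLimit`, item stmt-AtomisticToContinuum-12596;
`--supports` file proving the registered stub S7 verbatim, closes nothing; the same statement is the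
registered `stub_regularDLRUnique` of the sibling crux `GreenKuboContinuation`, line
temperature-blind-vitali-hurwitz, item stmt-AtomisticToContinuum-12597)

The registered stub: for `P = pinnedChain ω₂ lam β γ` (all `> 0`) and every `T > 0`, any two DLR
Gibbs states of `P` at `T` that are shift-invariant and satisfy Buttà–Marchioro's superstability
estimate (2.3) coincide.

Proof. The tree now has the full transfer-operator theory of the one-dimensional chain:
* `Literature.Analysis.OperatorTheory.exists_kernelRatio_tendsto_uniformly` (Jentzsch spectral gap
  of the compact, self-adjoint, positivity improving transfer operator with kernel `e^{-V(q'-q)/T}`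
  on `L²(e^{-(p²/2+U)/T} dq dp)` + power iteration: ratios of transfer-operator matrix elements forget
  the boundary spins, uniformly where the Perron–Frobenius overlap is bounded below);
* `lmarginal_interval_eq_iterate` / `InfiniteChainTransferBridge` (the finite-volume Gibbs kernel of
  an interval, peeled from both sides, IS such a ratio);
* `OscillatorChain.chainSpecification_Icc_tendsto_uniformly` (hence `γ_{ {a-N,…,a+n+N} }(A | η) → L`
  uniformly on bounded boundary positions);
* `OscillatorChain.eq_of_isChainGibbsMeasure_of_tight(_pinnedChain)` — **two DLR states with
  uniformly tight one-site position marginals coincide** (DLR equation + tightness; window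
  cylinders generate).
Buttà–Marchioro superstable states are one-site tight
(`oneSiteTight_of_hasSuperstabilityEstimate`, S6 worker's file), so the registered statement follows;
shift invariance is not even needed. As a by-product the tight-uniqueness hypothesis (TU) of the S6
reduction `stub_witnessRegularisationOfDynamicalTightness` is discharged: the seam
`stub_witnessRegularisation` now reduces to dynamical tightness (DT) alone
(`witnessRegularisation_of_dynamicalTightness`).
-/

noncomputable section

namespace Summit.AtomisticToContinuum.FouriersLaw.Theorems.AbelThermodynamicLimit.LoomisCompactHorizonWitness

open MeasureTheory Filter Set
open scoped ENNReal
open Literature.MathematicalPhysics.KineticTheory.HeatConduction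

/-- **Tight uniqueness (TU) for the pinned chain**: two DLR Gibbs states of `pinnedChain ω₂ lam β γ`
(`ω₂, lam, β > 0`) at `T > 0` with uniformly tight one-site position marginals coincide — the tree
theorem `OscillatorChain.eq_of_isChainGibbsMeasure_of_tight_pinnedChain` in the line's binder form.
[folklore] -/
theorem tightDLRUnique (ω₂ lam β γ : ℝ) (hω : 0 < ω₂) (hl : 0 < lam) (hβ : 0 < β) (T : ℝ)
    (hT : 0 < T) :
    ∀ μ₁ μ₂ : MeasureTheory.Measure
        Literature.MathematicalPhysics.KineticTheory.HeatConduction.ChainConfig,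
      (Literature.MathematicalPhysics.KineticTheory.HeatConduction.pinnedChain
          ω₂ lam β γ).IsChainGibbsMeasure T μ₁ →
      (∀ ε : ℝ, 0 < ε → ∃ R : ℝ, ∀ x : ℤ,
        μ₁ {σ : Literature.MathematicalPhysics.KineticTheory.HeatConduction.ChainConfig |
            R < |(σ x).1|} ≤ ENNReal.ofReal ε) →
      (Literature.MathematicalPhysics.KineticTheory.HeatConduction.pinnedChain
          ω₂ lam β γ).IsChainGibbsMeasure T μ₂ →
      (∀ ε : ℝ, 0 < ε → ∃ R : ℝ, ∀ x : ℤ,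
        μ₂ {σ : Literature.MathematicalPhysics.KineticTheory.HeatConduction.ChainConfig |
            R < |(σ x).1|} ≤ ENNReal.ofReal ε) →
      μ₁ = μ₂ :=
  fun _ _ hG₁ ht₁ hG₂ ht₂ =>
    OscillatorChain.eq_of_isChainGibbsMeasure_of_tight_pinnedChain γ hω hl.le hβ.le hT hG₁ hG₂ ht₁ ht₂

/-- **S7 `stub_regularDLRUnique` (registered on stmt-AtomisticToContinuum-12596 and -12597):
DLR uniqueness in the regular class.** For `P = pinnedChain ω₂ lam β γ` (all `> 0`) and every
`T > 0`, two DLR Gibbs states of `P` at `T` that are shift-invariant and obey Buttà–Marchioro's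
superstability estimate (2.3) coincide. Superstable states are one-site tight
(`oneSiteTight_of_hasSuperstabilityEstimate`), and tight DLR states are unique
(`OscillatorChain.eq_of_isChainGibbsMeasure_of_tight_pinnedChain`, transfer-operator proof:
Cassandro–Olivieri–Pellegrinotti–Presutti 1978 §2, Georgii 2011 Thm 10.25 / §11.1). [folklore] -/
theorem stub_regularDLRUnique :
    ∀ ω₂ lam β γ : ℝ, 0 < ω₂ → 0 < lam → 0 < β → 0 < γ →
      ∀ T : ℝ, 0 < T →
        ∀ μ₁ μ₂ : MeasureTheory.Measure
            Literature.MathematicalPhysics.KineticTheory.HeatConduction.ChainConfig,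
          (Literature.MathematicalPhysics.KineticTheory.HeatConduction.pinnedChain
                ω₂ lam β γ).IsChainGibbsMeasure T μ₁ →
          Literature.MathematicalPhysics.KineticTheory.HeatConduction.IsShiftInvariant μ₁ →
          (Literature.MathematicalPhysics.KineticTheory.HeatConduction.pinnedChain
                ω₂ lam β γ).HasSuperstabilityEstimate μ₁ →
          (Literature.MathematicalPhysics.KineticTheory.HeatConduction.pinnedChain
                ω₂ lam β γ).IsChainGibbsMeasure T μ₂ →
          Literature.MathematicalPhysics.KineticTheory.HeatConduction.IsShiftInvariant μ₂ →
          (Literature.MathematicalPhysics.KineticTheory.HeatConduction.pinnedChain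
                ω₂ lam β γ).HasSuperstabilityEstimate μ₂ → μ₁ = μ₂ := by
  intro ω₂ lam β γ hω hl hβ _hγ T hT μ₁ μ₂ hG₁ _hS₁ hss₁ hG₂ _hS₂ hss₂
  exact tightDLRUnique ω₂ lam β γ hω hl hβ T hT μ₁ μ₂ hG₁
    (oneSiteTight_of_hasSuperstabilityEstimate γ hω hl.le hβ.le hss₁) hG₂
    (oneSiteTight_of_hasSuperstabilityEstimate γ hω hl.le hβ.le hss₂)

/-- **The seam reduced to dynamical tightness alone.** With (TU) proved (`tightDLRUnique`), the S6
reduction `stub_witnessRegularisationOfDynamicalTightness` needs only (DT): if every DLR state of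
`P` at `T` preserved by some `InfiniteChainDynamics` with absolutely convergent current correlations is
one-site tight, then the seam `stub_witnessRegularisation` holds at `T`. [folklore] -/
theorem witnessRegularisation_of_dynamicalTightness :
    ∀ ω₂ lam β γ : ℝ, 0 < ω₂ → 0 < lam → 0 < β → 0 < γ →
      ∀ T : ℝ, 0 < T →
        (∀ (μ : MeasureTheory.Measure
                Literature.MathematicalPhysics.KineticTheory.HeatConduction.ChainConfig)
            (D : Literature.MathematicalPhysics.KineticTheory.HeatConduction.InfiniteChainDynamics
              (Literature.MathematicalPhysics.KineticTheory.HeatConduction.pinnedChain ω₂ lam β γ)),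
            (Literature.MathematicalPhysics.KineticTheory.HeatConduction.pinnedChain
                ω₂ lam β γ).IsChainGibbsMeasure T μ → D.PreservesMeasure μ →
            (∀ t : ℝ, D.HasAbsConvergentCorrelation μ t) →
            ∀ ε : ℝ, 0 < ε → ∃ R : ℝ, ∀ x : ℤ,
              μ {σ : Literature.MathematicalPhysics.KineticTheory.HeatConduction.ChainConfig |
                  R < |(σ x).1|} ≤ ENNReal.ofReal ε) →
        (∃ (μT : MeasureTheory.Measure
                Literature.MathematicalPhysics.KineticTheory.HeatConduction.ChainConfig)
            (D' : Literature.MathematicalPhysics.KineticTheory.HeatConduction.InfiniteChainDynamics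
              (Literature.MathematicalPhysics.KineticTheory.HeatConduction.pinnedChain ω₂ lam β γ))
            (κ : ℝ),
            (Literature.MathematicalPhysics.KineticTheory.HeatConduction.pinnedChain
                ω₂ lam β γ).IsChainGibbsMeasure T μT ∧ D'.PreservesMeasure μT ∧
            (∀ t : ℝ, D'.HasAbsConvergentCorrelation μT t) ∧ 0 < κ ∧
            Filter.Tendsto (fun ν : ℝ => (T ^ 2)⁻¹ *
              MeasureTheory.integral (MeasureTheory.volume.restrict (Set.Ioi (0:ℝ)))
                (fun t : ℝ => Real.exp (-(ν * t)) * D'.currentCorrelation μT t))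
              (nhdsWithin (0:ℝ) (Set.Ioi 0)) (nhds κ)) →
        ∃ (μT : MeasureTheory.Measure
                Literature.MathematicalPhysics.KineticTheory.HeatConduction.ChainConfig)
            (D' : Literature.MathematicalPhysics.KineticTheory.HeatConduction.InfiniteChainDynamics
              (Literature.MathematicalPhysics.KineticTheory.HeatConduction.pinnedChain ω₂ lam β γ))
            (κ : ℝ),
            (Literature.MathematicalPhysics.KineticTheory.HeatConduction.pinnedChain
                ω₂ lam β γ).IsChainGibbsMeasure T μT ∧
            Literature.MathematicalPhysics.KineticTheory.HeatConduction.IsShiftInvariant μT ∧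
            (Literature.MathematicalPhysics.KineticTheory.HeatConduction.pinnedChain
                ω₂ lam β γ).HasSuperstabilityEstimate μT ∧
            D'.PreservesMeasure μT ∧
            (∀ t : ℝ, D'.HasAbsConvergentCorrelation μT t) ∧ 0 < κ ∧
            Filter.Tendsto (fun ν : ℝ => (T ^ 2)⁻¹ *
              MeasureTheory.integral (MeasureTheory.volume.restrict (Set.Ioi (0:ℝ)))
                (fun t : ℝ => Real.exp (-(ν * t)) * D'.currentCorrelation μT t))
              (nhdsWithin (0:ℝ) (Set.Ioi 0)) (nhds κ) :=
  fun ω₂ lam β γ hω hl hβ hγ T hT hDT =>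
    stub_witnessRegularisationOfDynamicalTightness ω₂ lam β γ hω hl hβ hγ T hT hDT
      (tightDLRUnique ω₂ lam β γ hω hl hβ T hT)

end Summit.AtomisticToContinuum.FouriersLaw.Theorems.AbelThermodynamicLimit.LoomisCompactHorizonWitness

end
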